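import Summits.CriticalPhenomena.PercolationContinuityZ3.Theorems.PercNearOneGluingNoHeavyLowerTailSahiThreeCopyCellF7p2222222Cells1

/-!
# `NoHeavyLowerTail` (crux stmt-CriticalPhenomena-4575), Sahi programme: ★★ `LawGood` for `F7` at class `2222222` — assembly of the Borda cells

Support file (Sahi cell, seat `prim-sahi-p1`, generation 65; `--supports stmt-CriticalPhenomena-4575`). [this work]
-/

namespace Summit.CriticalPhenomena.PercolationContinuityZ3.Theorems.SahiThreeCopy

open Finset Function Literature.Combinatorics.Sahi2008
open scoped BigOperators

/-- ★ Borda-cell facts for ALL 36 ordered cells of `F72222222`. [this work] -/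
theorem F72222222B_all : ∀ a b, a < 6 → b < 6 → F72222222B a b := by
  intro a b ha hb
  interval_cases a <;> interval_cases b
  exacts [F72222222c0_0, F72222222c0_1, F72222222c0_2, F72222222c0_3, F72222222c0_4, F72222222c0_5, F72222222c1_0, F72222222c1_1, F72222222c1_2, F72222222c1_3, F72222222c1_4, F72222222c1_5,
    F72222222c2_0, F72222222c2_1, F72222222c2_2, F72222222c2_3, F72222222c2_4, F72222222c2_5, F72222222c3_0, F72222222c3_1, F72222222c3_2, F72222222c3_3, F72222222c3_4, F72222222c3_5,
    F72222222c4_0, F72222222c4_1, F72222222c4_2, F72222222c4_3, F72222222c4_4, F72222222c4_5, F72222222c5_0, F72222222c5_1, F72222222c5_2, F72222222c5_3, F72222222c5_4, F72222222c5_5]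

/-- ★★ `PointwiseTP` for `F72222222` (Borda/chain cells). [this work] -/
theorem pointwiseTP_F72222222 : PointwiseTP 7 (prof7 127) (setInd F7set) := by
  rw [setInd_F7set_eq]; exact pointwiseTP_of_exists_cellFacts (by norm_num) _ F72222222B_all

/-- ★★ `LawGood` for `F72222222`. [this work] -/
theorem lawGood_F72222222 : LawGood 7 (prof7 127) (setInd F7set) :=
  lawGood_of_pointwiseTP pointwiseTP_F72222222

end Summit.CriticalPhenomena.PercolationContinuityZ3.Theorems.SahiThreeCopy
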